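import Summits.CriticalPhenomena.PercolationContinuityZ3.Theorems.PercNearOneGluingNoHeavyLowerTailMajorityGluingQCert3
import HarnessLib

/-!
# Soundness of the degree-3 certificates (lane prim-rate, constants-miner 1, gen 34; NEXT-g35 item 1)

Support file for the closed crux `NoHeavyLowerTail` (stmt-CriticalPhenomena-4575), majority-gluing line; companion of `…MajorityGluingQCert3` (the cubic language and
its expansion into contributions).  Here: the valuation `val3` of cubic monomial keys at a real point (`val3_key3`: the key of `x_i x_j x_k` evaluates to `v_i v_j v_k`), the
values of the contribution lists of every entry kind (`evalC_ell2C`, `evalC_lin3C`, `evalC_prodC`, `evalC_sq3C`), and **`Cert3.sound3`**: if `checkW3` and `checkQ3 fuel` pass,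
then at every nonnegative point satisfying the marginal hypotheses, the case chain and the listed van den Berg–Kahn rows (the same hypotheses as `Cert.sound`),
`cD·T(v) ≤ cN·v_D`.  No percolation, no sorries.
-/

namespace Summit.CriticalPhenomena.PercolationContinuityZ3.Theorems

namespace HubOnly
namespace QCert

noncomputable section

/-! ### Valuation of keys -/

/-- The value `v_a·v_b·v_c` of the key `c + N(b + N a)`. -/
def val3 (N : ℕ) (v : ℕ → ℝ) (key : ℕ) : ℝ := v (key / N / N) * v (key / N % N) * v (key % N)

/-- `val3` is nonnegative at a nonnegative point. -/
theorem val3_nonneg (N : ℕ) (v : ℕ → ℝ) (hv : ∀ i, 0 ≤ v i) (key : ℕ) : 0 ≤ val3 N v key :=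
  mul_nonneg (mul_nonneg (hv _) (hv _)) (hv _)

/-- The components of `sort3` are the arguments, as a product. -/
theorem sort3_prod (v : ℕ → ℝ) (i j k : ℕ) :
    v (sort3 i j k).1 * v (sort3 i j k).2.1 * v (sort3 i j k).2.2 = v i * v j * v k := by
  unfold sort3; split_ifs <;> simp only [] <;> ring

/-- The components of `sort3` are bounded like the arguments. -/
theorem sort3_lt {N i j k : ℕ} (hi : i < N) (hj : j < N) (hk : k < N) :
    (sort3 i j k).1 < N ∧ (sort3 i j k).2.1 < N ∧ (sort3 i j k).2.2 < N := by
  unfold sort3; split_ifs <;> simp only [] <;> exact ⟨by assumption, by assumption, by assumption⟩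

/-- Decoding `enc3`. -/
theorem dec_enc3 {N a b c : ℕ} (hb : b < N) (hc : c < N) :
    enc3 N (a, b, c) % N = c ∧ enc3 N (a, b, c) / N % N = b ∧ enc3 N (a, b, c) / N / N = a := by
  have hN : 0 < N := by omega
  unfold enc3
  simp only []
  have h1 : (c + N * (b + N * a)) / N = b + N * a := by
    rw [Nat.add_mul_div_left _ _ hN, Nat.div_eq_of_lt hc, zero_add]
  refine ⟨?_, ?_, ?_⟩
  · rw [Nat.add_mul_mod_self_left, Nat.mod_eq_of_lt hc]
  · rw [h1, Nat.add_mul_mod_self_left, Nat.mod_eq_of_lt hb]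
  · rw [h1, Nat.add_mul_div_left _ _ hN, Nat.div_eq_of_lt hb, zero_add]

/-- **The key of `x_i x_j x_k` evaluates to `v_i·v_j·v_k`.** -/
theorem val3_key3 {N : ℕ} (v : ℕ → ℝ) {i j k : ℕ} (hi : i < N) (hj : j < N) (hk : k < N) :
    val3 N v (key3 N i j k) = v i * v j * v k := by
  obtain ⟨h1, h2, h3⟩ := sort3_lt hi hj hk
  have hd := dec_enc3 (N := N) (a := (sort3 i j k).1) h2 h3
  unfold val3 key3
  rw [hd.1, hd.2.1, hd.2.2]
  exact sort3_prod v i j k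

/-! ### Sums over supports -/

/-- A sum over `suppOf N P` is the restricted sum over `range N`. -/
theorem sum_suppOf (N : ℕ) (P : ℕ → Bool) (f : ℕ → ℝ) :
    ((suppOf N P).map f).sum = ∑ i ∈ Finset.range N, (if P i then f i else 0) := by
  unfold suppOf
  induction N with
  | zero => simp
  | succ N ih =>
    rw [List.range_succ, List.filter_append, List.map_append, List.sum_append, ih, Finset.sum_range_succ]
    congr 1
    by_cases hP : P N = true
    · simp [hP]
    · simp [hP]

/-- The `0/1`-form of `P` is the sum of `v` over `suppOf N P`. -/
theorem linv_bi_eq_suppOf (N : ℕ) (P : ℕ → Bool) (v : ℕ → ℝ) :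
    linv N (fun i => Cert.bi (P i)) v = ((suppOf N P).map v).sum := by
  rw [sum_suppOf]; unfold linv
  refine Finset.sum_congr rfl fun i _ => ?_
  by_cases h : P i = true
  · simp [Cert.bi, h]
  · simp [Cert.bi, h]

/-- Every member of `suppOf N P` is `< N` and satisfies `P`. -/
theorem mem_suppOf {N : ℕ} {P : ℕ → Bool} {i : ℕ} (h : i ∈ suppOf N P) : i < N ∧ P i = true := by
  unfold suppOf at h; rw [List.mem_filter, List.mem_range] at h; exact h

/-- `evalC` of a mapped list. -/
theorem evalC_map {α : Type*} (val : ℕ → ℝ) (l : List α) (g : α → ℕ × ℤ) :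
    evalC val (l.map g) = (l.map fun x => ((g x).2 : ℝ) * val (g x).1).sum := by
  unfold evalC; rw [List.map_map]; rfl

/-- A mapped sum with a common factor, over a support list: `Σ_{i∈supp} z·(v_i·w) = z·w·Σ v_i`. -/
theorem sum_map_mul (l : List ℕ) (v : ℕ → ℝ) (g : ℕ → ℝ) (z : ℝ) (hg : ∀ i ∈ l, g i = z * v i) :
    (l.map g).sum = z * (l.map v).sum := by
  induction l with
  | nil => simp
  | cons a l ih =>
    simp only [List.map_cons, List.sum_cons]
    rw [hg a (by simp), ih (fun i hi => hg i (List.mem_cons_of_mem _ hi))]; ring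

/-! ### Values of the entry contributions -/

/-- **Product contributions:** `evalC (prodC N m1 m2 t z) = z·f₁(v)·f₂(v)·v_t`. -/
theorem evalC_prodC {N : ℕ} (v : ℕ → ℝ) (m1 m2 t : ℕ) (z : ℤ) (ht : t < N) :
    evalC (val3 N v) (Cert3.prodC N m1 m2 t z) =
      (z : ℝ) * (linv N (fun i => Cert.bi (tb m1 i)) v * linv N (fun i => Cert.bi (tb m2 i)) v) * v t := by
  unfold Cert3.prodC
  rw [evalC_flatten, List.map_map, linv_bi_eq_suppOf, linv_bi_eq_suppOf]
  have inner : ∀ i ∈ suppOf N (tb m1), (evalC (val3 N v) ∘ fun i => (suppOf N (tb m2)).map fun j => (key3 N i j t, z)) i =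
      ((z : ℝ) * v t * ((suppOf N (tb m2)).map v).sum) * v i := by
    intro i hi
    have hi' := (mem_suppOf hi).1
    rw [Function.comp_apply, evalC_map,
      sum_map_mul _ v _ ((z : ℝ) * v t * v i) (fun j hj => by simp only [val3_key3 v hi' (mem_suppOf hj).1 ht]; ring)]
    ring
  rw [sum_map_mul _ v _ ((z : ℝ) * v t * ((suppOf N (tb m2)).map v).sum) inner]
  ring

/-- The support of `u` lies in the bits of `m1 ||| m2`. -/
theorem SqE.u_eq_zero (s : SqE) (i : ℕ) (h : tb (s.m1 ||| s.m2) i = false) : s.u i = 0 := by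
  rw [tb_eq, Nat.testBit_lor, Bool.or_eq_false_iff] at h
  unfold SqE.u; rw [tb_eq, tb_eq, h.1, h.2]; simp

/-- `u(v)` as a sum over the support of `m1 ||| m2`. -/
theorem linv_u_eq_suppOf (N : ℕ) (s : SqE) (v : ℕ → ℝ) :
    linv N s.u v = ((suppOf N (tb (s.m1 ||| s.m2))).map fun i => (s.u i : ℝ) * v i).sum := by
  rw [sum_suppOf]; unfold linv
  refine Finset.sum_congr rfl fun i _ => ?_
  by_cases h : tb (s.m1 ||| s.m2) i = true
  · rw [if_pos h]
  · rw [if_neg h, SqE.u_eq_zero s i (by simpa using h)]; simp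

/-- **Square contributions:** `evalC (sq3C s) = −n·u(v)²·v_t`. -/
theorem Cert3.evalC_sq3C (c : Cert3) (v : ℕ → ℝ) (s : SqE3) (ht : s.t < c.NV) :
    evalC (val3 c.NV v) (c.sq3C s) = -((s.sq.n : ℝ) * (linv c.NV s.sq.u v * linv c.NV s.sq.u v)) * v s.t := by
  unfold Cert3.sq3C
  rw [evalC_flatten, List.map_map, linv_u_eq_suppOf]
  set U := suppOf c.NV (tb (s.sq.m1 ||| s.sq.m2)) with hU
  have inner : ∀ i ∈ U, (evalC (val3 c.NV v) ∘ fun i => U.map fun j => (key3 c.NV i j s.t, -((s.sq.n : ℤ) * s.sq.u i * s.sq.u j))) i =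
      (-(s.sq.n : ℝ) * v s.t * (U.map fun j => (s.sq.u j : ℝ) * v j).sum) * ((s.sq.u i : ℝ) * v i) := by
    intro i hi
    have hi' := (mem_suppOf hi).1
    rw [Function.comp_apply, evalC_map, sum_map_mul _ (fun j => (s.sq.u j : ℝ) * v j) _ (-(s.sq.n : ℝ) * v s.t * ((s.sq.u i : ℝ) * v i))
      (fun j hj => by simp only [val3_key3 v hi' (mem_suppOf hj).1 ht]; push_cast; ring)]
    ring
  rw [sum_map_mul _ (fun i => (s.sq.u i : ℝ) * v i) _ _ inner]
  ring

namespace Cert3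

variable (c : Cert3)

/-- `D < NV`. -/
theorem D_lt_NV : c.base.D < c.NV := c.base.D_lt_NV

/-- **`ell2` contributions:** `n·(cN·v_D − cD·T(v))·v_a·v_b`. -/
theorem evalC_ell2C (v : ℕ → ℝ) (e : ℕ × ℕ × ℕ) (ha : e.1 < c.NV) (hb : e.2.1 < c.NV) :
    evalC (val3 c.NV v) (c.ell2C e) = (e.2.2 : ℝ) * c.base.Λ v * (v e.1 * v e.2.1) := by
  unfold ell2C Cert.Λ
  rw [evalC, List.map_cons, List.sum_cons, ← evalC, evalC_map, val3_key3 v c.D_lt_NV ha hb, linv_bi_eq_suppOf,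
    sum_map_mul _ v _ (-((e.2.2 : ℝ) * c.base.cD) * (v e.1 * v e.2.1)) (fun i hi => by
      simp only [val3_key3 v (mem_suppOf hi).1 ha hb]; push_cast; ring)]
  push_cast; ring

/-- **`lin3` contributions**, kind `1`: `−n·(v_D − m_x(v))·v_a v_b`. -/
theorem evalC_lin3C_one (v : ℕ → ℝ) (e : ℕ × ℕ × ℕ × ℕ × ℕ) (hk : e.1 = 1) (ha : e.2.2.1 < c.NV) (hb : e.2.2.2.1 < c.NV) :
    evalC (val3 c.NV v) (c.lin3C e) =
      -((e.2.2.2.2 : ℝ) * (v c.base.D - linv c.NV (fun i => Cert.bi (c.base.margMem e.2.1 i)) v) * (v e.2.2.1 * v e.2.2.2.1)) := by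
  unfold lin3C
  rw [if_pos hk, evalC, List.map_cons, List.sum_cons, ← evalC, evalC_map, val3_key3 v c.D_lt_NV ha hb, linv_bi_eq_suppOf,
    sum_map_mul _ v _ ((e.2.2.2.2 : ℝ) * (v e.2.2.1 * v e.2.2.2.1)) (fun i hi => by
      simp only [val3_key3 v (mem_suppOf hi).1 ha hb]; push_cast; ring)]
  push_cast; ring

/-- **`lin3` contributions**, kind `≠ 1`: `−n·(E_{x+1}(v) − E_x(v))·v_a v_b`. -/
theorem evalC_lin3C_two (v : ℕ → ℝ) (e : ℕ × ℕ × ℕ × ℕ × ℕ) (hk : e.1 ≠ 1) (ha : e.2.2.1 < c.NV) (hb : e.2.2.2.1 < c.NV) :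
    evalC (val3 c.NV v) (c.lin3C e) =
      -((e.2.2.2.2 : ℝ) * (linv c.NV (fun i => Cert.bi (c.base.eMem (e.2.1 + 1) i)) v -
        linv c.NV (fun i => Cert.bi (c.base.eMem e.2.1 i)) v) * (v e.2.2.1 * v e.2.2.2.1)) := by
  unfold lin3C
  rw [if_neg hk, evalC_append, evalC_map, evalC_map, linv_bi_eq_suppOf, linv_bi_eq_suppOf,
    sum_map_mul (suppOf c.NV (c.base.eMem (e.2.1 + 1))) v _ (-(e.2.2.2.2 : ℝ) * (v e.2.2.1 * v e.2.2.2.1)) (fun i hi => by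
      simp only [val3_key3 v (mem_suppOf hi).1 ha hb]; push_cast; ring),
    sum_map_mul (suppOf c.NV (c.base.eMem e.2.1)) v _ ((e.2.2.2.2 : ℝ) * (v e.2.2.1 * v e.2.2.2.1)) (fun i hi => by
      simp only [val3_key3 v (mem_suppOf hi).1 ha hb]; push_cast; ring)]
  ring

/-- **Row contributions:** `−n·(f₃f₄ − f₁f₂)(v)·v_t`. -/
theorem evalC_row3C (v : ℕ → ℝ) (r : RowE3) (ht : r.t < c.NV) :
    evalC (val3 c.NV v) (c.row3C r) =
      -((r.row.n : ℝ) * (linv c.NV (fun i => Cert.bi (tb r.row.m3 i)) v * linv c.NV (fun i => Cert.bi (tb r.row.m4 i)) v -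
        linv c.NV (fun i => Cert.bi (tb r.row.m1 i)) v * linv c.NV (fun i => Cert.bi (tb r.row.m2 i)) v)) * v r.t := by
  unfold row3C
  rw [evalC_append, evalC_prodC v _ _ _ _ ht, evalC_prodC v _ _ _ _ ht]
  push_cast; ring

/-! ### Soundness -/

/-- Facts extracted from `checkW3`. -/
theorem checkW3_spec (h : c.checkW3 = true) :
    0 < c.base.cD ∧ 1 ≤ c.base.h ∧ 0 < c.ell2DD ∧ (∀ e ∈ c.ell2, e.1 < c.NV ∧ e.2.1 < c.NV) ∧
    (∀ e ∈ c.lin3, ((e.1 = 1 ∧ e.2.1 < c.base.m) ∨ (e.1 = 2 ∧ e.2.1 + 1 < c.base.m)) ∧ e.2.2.1 < c.NV ∧ e.2.2.2.1 < c.NV) ∧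
    (∀ ch ∈ c.rows, ∀ r ∈ ch, c.base.rowOK r.row = true ∧ r.t < c.NV) ∧ (∀ ch ∈ c.sqs, ∀ s ∈ ch, s.t < c.NV) := by
  unfold checkW3 at h
  simp only [Bool.and_eq_true] at h
  obtain ⟨⟨⟨⟨⟨⟨h1, h2⟩, h3⟩, h4⟩, h5⟩, h6⟩, h7⟩ := h
  rw [List.all_eq_true] at h4 h5 h6 h7
  refine ⟨of_decide_eq_true h1, of_decide_eq_true h2, of_decide_eq_true h3, fun e he => ?_, fun e he => ?_, fun ch hch r hr => ?_,
    fun ch hch s hs => ?_⟩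
  · have h := h4 e he
    simp only [Bool.and_eq_true, decide_eq_true_eq] at h
    exact h
  · have h := h5 e he
    simp only [Bool.and_eq_true, Bool.or_eq_true, decide_eq_true_eq] at h
    exact ⟨h.1.1, h.1.2, h.2⟩
  · have h := h6 ch hch
    rw [List.all_eq_true] at h
    have h' := h r hr
    simp only [Bool.and_eq_true, decide_eq_true_eq] at h'
    exact h'
  · have h := h7 ch hch
    rw [List.all_eq_true] at h
    exact of_decide_eq_true (h s hs)

/-- The quadratic multiplier `ℓ₂(v) = Σ n·v_a·v_b`. -/
def ell2v (v : ℕ → ℝ) : ℝ := (c.ell2.map fun e => (e.2.2 : ℝ) * (v e.1 * v e.2.1)).sum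

/-- `ℓ₂(v) ≥ ℓ₂[δ²]·v_D²` at a nonnegative point. -/
theorem ell2DD_mul_le (v : ℕ → ℝ) (hv : ∀ i, 0 ≤ v i) : (c.ell2DD : ℝ) * (v c.base.D * v c.base.D) ≤ c.ell2v v := by
  unfold ell2DD ell2v
  rw [natCast_listSum, ← listSum_mul_const]
  refine listSum_mono _ _ _ fun e _ => ?_
  split_ifs with h
  · rw [h.1, h.2]
  · rw [Nat.cast_zero, zero_mul]; exact mul_nonneg (Nat.cast_nonneg _) (mul_nonneg (hv _) (hv _))

/-- **SOUNDNESS OF THE DEGREE-3 CERTIFICATES.**  If `checkW3` and `checkQ3 fuel` pass, then at every nonnegative point `v` satisfying the marginal hypotheses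
`m_x(v) ≤ v_D` (`x < m`), the case chain `E_x(v) ≤ E_{x+1}(v)` (`x + 1 < m`) and the listed rows on the mask forms (`f₁·f₂ ≤ f₃·f₄`), `cD·T(v) ≤ cN·v_D`. -/
theorem sound3 (fuel : ℕ) (hW : c.checkW3 = true) (hQ : c.checkQ3 fuel = true) (v : ℕ → ℝ) (hv : ∀ i, 0 ≤ v i)
    (hmarg : ∀ x < c.base.m, linv c.NV (fun i => Cert.bi (c.base.margMem x i)) v ≤ v c.base.D)
    (hcase : ∀ x, x + 1 < c.base.m →
      linv c.NV (fun i => Cert.bi (c.base.eMem x i)) v ≤ linv c.NV (fun i => Cert.bi (c.base.eMem (x + 1) i)) v)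
    (hrows : ∀ ch ∈ c.rows, ∀ r ∈ ch,
      linv c.NV (fun i => Cert.bi (tb r.row.m1 i)) v * linv c.NV (fun i => Cert.bi (tb r.row.m2 i)) v ≤
        linv c.NV (fun i => Cert.bi (tb r.row.m3 i)) v * linv c.NV (fun i => Cert.bi (tb r.row.m4 i)) v) :
    (c.base.cD : ℝ) * linv c.NV (fun i => Cert.bi (c.base.tMem i)) v ≤ c.base.cN * v c.base.D := by
  obtain ⟨_, hh, hDD, hell, hlin, hrow, hsq⟩ := c.checkW3_spec hW
  -- the whole contribution list is nonnegative at `val3`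
  have hpos : 0 ≤ evalC (val3 c.NV v) c.contribs := evalC_nonneg_of_runsOK_msortK _ (val3_nonneg _ v hv) fuel _ hQ
  -- split it
  have hsplit : evalC (val3 c.NV v) c.contribs =
      ((c.ell2.map c.ell2C).map (evalC (val3 c.NV v))).sum + ((c.lin3.map c.lin3C).map (evalC (val3 c.NV v))).sum +
      ((c.rows.map fun ch => (ch.map c.row3C).flatten).map (evalC (val3 c.NV v))).sum +
      ((c.sqs.map fun ch => (ch.map c.sq3C).flatten).map (evalC (val3 c.NV v))).sum := by
    unfold contribs; rw [evalC_append, evalC_append, evalC_append, evalC_flatten, evalC_flatten, evalC_flatten, evalC_flatten]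
  -- the four parts
  have h1 : ((c.ell2.map c.ell2C).map (evalC (val3 c.NV v))).sum = c.base.Λ v * c.ell2v v := by
    rw [List.map_map]
    have hc : c.ell2.map (evalC (val3 c.NV v) ∘ c.ell2C) = c.ell2.map (fun e => ((e.2.2 : ℝ) * (v e.1 * v e.2.1)) * c.base.Λ v) :=
      List.map_congr_left fun e he => by rw [Function.comp_apply, c.evalC_ell2C v e (hell e he).1 (hell e he).2]; ring
    rw [hc, listSum_mul_const, ell2v, mul_comm]
  have h2 : ((c.lin3.map c.lin3C).map (evalC (val3 c.NV v))).sum ≤ 0 := by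
    rw [List.map_map]
    refine listSum_nonpos _ _ fun e he => ?_
    obtain ⟨hk, ha, hb⟩ := hlin e he
    rw [Function.comp_apply]
    have hab : 0 ≤ (e.2.2.2.2 : ℝ) * (v e.2.2.1 * v e.2.2.2.1) := mul_nonneg (Nat.cast_nonneg _) (mul_nonneg (hv _) (hv _))
    rcases hk with ⟨hk1, hx⟩ | ⟨hk2, hx⟩
    · rw [c.evalC_lin3C_one v e hk1 ha hb]
      have := hmarg e.2.1 hx
      nlinarith
    · rw [c.evalC_lin3C_two v e (by omega) ha hb]
      have := hcase e.2.1 hx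
      nlinarith
  have h3 : ((c.rows.map fun ch => (ch.map c.row3C).flatten).map (evalC (val3 c.NV v))).sum ≤ 0 := by
    rw [List.map_map]
    refine listSum_nonpos _ _ fun ch hch => ?_
    rw [Function.comp_apply, evalC_flatten, List.map_map]
    refine listSum_nonpos _ _ fun r hr => ?_
    rw [Function.comp_apply, c.evalC_row3C v r (hrow ch hch r hr).2]
    have hr' := hrows ch hch r hr
    have hn : (0 : ℝ) ≤ r.row.n := Nat.cast_nonneg _
    have hprod := mul_nonneg (mul_nonneg hn (sub_nonneg.2 hr')) (hv r.t)
    linarith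
  have h4 : ((c.sqs.map fun ch => (ch.map c.sq3C).flatten).map (evalC (val3 c.NV v))).sum ≤ 0 := by
    rw [List.map_map]
    refine listSum_nonpos _ _ fun ch hch => ?_
    rw [Function.comp_apply, evalC_flatten, List.map_map]
    refine listSum_nonpos _ _ fun s hs => ?_
    rw [Function.comp_apply, c.evalC_sq3C v s (hsq ch hch s hs)]
    have hsqnn := mul_self_nonneg (linv c.NV s.sq.u v)
    have hn : (0 : ℝ) ≤ s.sq.n := Nat.cast_nonneg _
    have ht : 0 ≤ v s.t := hv _
    have := mul_nonneg (mul_nonneg hn hsqnn) ht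
    linarith
  have hmain : 0 ≤ c.base.Λ v * c.ell2v v := by rw [hsplit, h1] at hpos; linarith
  have hell2 := c.ell2DD_mul_le v hv
  rcases eq_or_lt_of_le (hv c.base.D) with hD | hD
  · -- `v_D = 0`
    rw [c.base.tForm_eq_zero hh v hv hmarg hD.symm, ← hD, mul_zero, mul_zero]
  · have hpos2 : 0 < c.ell2v v := lt_of_lt_of_le (mul_pos (by exact_mod_cast hDD) (mul_pos hD hD)) hell2
    have hΛ : 0 ≤ c.base.Λ v := by
      by_contra hneg
      push Not at hneg
      have := mul_neg_of_neg_of_pos hneg hpos2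
      linarith
    unfold Cert.Λ at hΛ
    linarith


end Cert3

end

end QCert
end HubOnly

end Summit.CriticalPhenomena.PercolationContinuityZ3.Theorems
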